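import Summits.QuantumFields.YangMills.Theorems.BalabanUVNodesN15KingModelPotentialCoherenceTight
import Summits.QuantumFields.YangMills.Theorems.BalabanUVNodesN15KingModelPotentialDressedSiteGrad

/-!
# N15 (NE2⁺), King-model rung, part 21: SIZE ALONE DOES NOT GIVE THE SITE LAYER — `¬ NE2PlusSite` for the dressed minimiser on the size-only sort

Cell `pub-ymgap-dag-n15-d` (R134 acceleration DAG, node N15 = NE2, strategy s3 KING-MODEL RUNG), part 21.  Part 15 (`…PotentialDressedSite`)
inhabited `T4EtaRate.NE2PlusSite` for the dressed minimiser's (3.133) sup entry `kingHSiteV` BY NAME on the size-AND-coherence sort `potBgSC`,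
and explained in prose («WHY TWO SORTS») why on part 8c's sort `potBg` (whose (3.35) slot is SIZE ONLY) the predicate should fail: the tower
`v_{L^k} ≡ c₃₅α₀`, `v_{L·L^k} ≡ 0` is (3.35)-regular and its dressed difference has an `O(α₀)` part not decaying in `k`.  THIS FILE PROVES IT:

* §1 a uniform MASS GAP for King's symbol (4.5): `Δ^{(k)}_{M+t}(p′) − Δ^{(k)}_M(p′) ≥ G(a, M, t) > 0` on the Brillouin zone, uniformly in `N`
  (`DeltaEff_mass_gap`; the `l = 0` alias term of `S_M − S_{M+t}`, the identity `S₁⁻¹ − S₂⁻¹ = (S₂ − S₁)S₁⁻¹S₂⁻¹`, the tree's `DeltaEff_ge_mass`);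
* §2 by (4.35) + Plancherel: `⟨φ, (Δ^{(k)}_{m²+t} − Δ^{(k)}_{m²})φ⟩ ≥ G‖φ‖²`, `(Δ^{(k)}_{m²+t} − Δ^{(k)}_{m²})(b,b) ≥ G` (`effLaplacian_mass_gap_form ∕ _diag`);
* §3 a CONSTANT potential is a mass shift: `A₀ + diag(t·1) = A₀|_{m² ↦ m²+t}` and `ℋ_{k,t·1} = ℋ_k|_{m² ↦ m²+t}` (`fineOpPot_const`, `kingHPot_const`);
* §4 THE LOWER BOUND: on the King-admissible tori, for the size-regular tower `v_{L^k} ≡ c`, `v_{L·L^k} ≡ 0` (`c > 0`),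
  `sup_{B(x′) = b} |ℋ_{k+1,v}(x′,b) − ℋ_{k,v}(x,b)| ≥ g − C_S(L^{−1∕2})^k`, `g = G_min∕a > 0` — each coarse point `x ∈ B(b)` lies under a fine point
  of the block (`overOff`), so the sup dominates the block MEAN of `ℋ_k^{m²}(·,b) − ℋ_k^{m²+c}(·,b)` (= `a_k⁻¹(Δ_{m²+c} − Δ_{m²})(b,b)` by part 20's
  `blockMean_kingH_eq`) up to the undressed step `C_S(L^{−1∕2})^k` of part 8b (`siteSup_sizeOnly_ge`, `kingHSiteV_sizeOnly_ge`);
* §5 ★★ `not_ne2PlusSite_kingHV : ¬ NE2PlusSite d′ p c₃₅ (kingInstanceV L s) (kingHSiteV L a m² s)` for EVERY `c₃₅ > 0`, `s`, `d′`, `p`: given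
  the predicate's constants `(M₅, δ, a₀, C, γ)`, the index `(e, k, n, Msz) = (0, k, 1, max M₅ 1)` with `k` large and the tower above at
  `c = c₃₅a₀∕Msz` violate `EtaRateIneqSite` at `(b, b)`.  Together with part 15's `ne2PlusSite_kingHSC` (the SAME kernel on the size-and-coherence
  sort) this decides the slot question by theorems.

HONEST SCOPE.  King's A = 0 scalar model on the King-admissible tori `Π ℤ∕(2L^{e+1})`, odd `L ≥ 3`, `a, m² > 0` (§§1–3 on any torus, `L ≥ 2`);
scalar potentials (NOT gauge fields); a NEGATIVE statement about THIS LINEAGE's family∕sort (`kingInstanceV`, `potBg`), not about a printed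
proposition and not about Bałaban's `H_k(U)`; count-neutral (`--supports`), not a discharge of N15; THEOREMS ONLY (0 `def`, 0 `sorry`).

References: C. King, Commun. Math. Phys. 102 (1986) 649–677: (2.13)–(2.15) p.653, (4.3)–(4.5) p.670, (4.35) p.674, Prop. 3.8 (3.71) p.664
(bib key `King1986`); [B9] = Bałaban, Commun. Math. Phys. 102 (1985) 385–462, (3.35)–(3.36) p.396, (3.133) p.422, Thm 3.14 pp.426–427
(quantifier template) (bib key `Balaban1985BackgroundPropagators`).
-/

noncomputable section
open scoped BigOperators Matrix
open Finset

namespace Summit.QuantumFields.YangMills.BalabanUVNodes.N15.KingModel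

open Literature.MathematicalPhysics.QuantumFieldTheory.Balaban1983to89 hiding blockOf
open Literature.MathematicalPhysics.QuantumFieldTheory.Balaban1983to89.T4EtaRate (PairedInstance NE2PlusSite EtaRateIneqSite rateFactor)
open Literature.MathematicalPhysics.QuantumFieldTheory.Balaban1983to89.B5Prop11Plancherel (Tor fine sOf abs_sOf_le)
open Literature.MathematicalPhysics.QuantumFieldTheory.King1986 (aK aK_pos DeltaEff composedInvResc shiftr_zero)
open Literature.MathematicalPhysics.QuantumFieldTheory.King1986.Torus
open Summit.QuantumFields.YangMills.BalabanUVNodes.N15KingModelRung (kingH kingBlockFibre mem_kingBlockFibre kingBlockFibre_nonempty)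
open Summit.QuantumFields.YangMills.BalabanUVNodes.N15KingModelRung.Curved (underPtN val_underPtN blockOf_underPtN)
open Real

variable {d : ℕ}

/-! ## §1 A uniform mass gap for King's symbol (4.5) -/

section Symbol

variable {dd : ℕ}

/-- THE `l = 0` ALIAS TERM OF `S_M − S_{M+t}`: `(4∕π²)^d·t∕((dπ²+M)(dπ²+M+t)) ≤ Σ_l|u|²Δ^η_M⁻¹ − Σ_l|u|²Δ^η_{M+t}⁻¹` on the Brillouin zone
(`N ≥ 1`, `M > 0`, `t ≥ 0`). [cite: King1986, (4.3)–(4.5) p.670 (the alias sum)] -/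
theorem composedInvResc_mass_gap (c : ℝ) {N : ℕ} (hN : 1 ≤ N) {M : ℝ} (hM : 0 < M) {t : ℝ} (ht : 0 ≤ t) {y : Fin dd → ℝ}
    (hy : ∀ μ, |y μ| ≤ π) :
    (4 / π ^ 2) ^ dd * t / (((dd : ℝ) * π ^ 2 + M) * ((dd : ℝ) * π ^ 2 + (M + t)))
      ≤ composedInvResc c N M y - composedInvResc c N (M + t) y := by
  haveI : NeZero N := ⟨by omega⟩
  have hshift : ∀ s : Fin dd → ℝ, B4Strip.DeltaXir N (M + t) s = B4Strip.DeltaXir N M s + t := fun s => by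
    unfold B4Strip.DeltaXir
    ring
  have hDpos : ∀ s : Fin dd → ℝ, 0 < B4Strip.DeltaXir N M s := fun s => by
    have h0 := B4Strip.DeltaXir_nonneg N 0 le_rfl s
    unfold B4Strip.DeltaXir at h0 ⊢
    linarith
  unfold composedInvResc
  rw [add_sub_add_left_eq_sub, ← Finset.sum_sub_distrib]
  have hterm : ∀ m : Fin dd → Fin N, 0 ≤ B4Strip.Ur N m y * (B4Strip.DeltaXir N M (B4Strip.shiftr N m y))⁻¹
      - B4Strip.Ur N m y * (B4Strip.DeltaXir N (M + t) (B4Strip.shiftr N m y))⁻¹ := fun m => by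
    rw [← mul_sub, hshift]
    refine mul_nonneg (B4Strip.Ur_nonneg N m y) (sub_nonneg.mpr (inv_anti₀ (hDpos _) (by linarith)))
  refine le_trans ?_ (Finset.single_le_sum (fun m _ => hterm m) (Finset.mem_univ (fun _ => (0 : Fin N))))
  rw [shiftr_zero, ← mul_sub, hshift]
  set D : ℝ := B4Strip.DeltaXir N M y with hDdef
  have hD0 : 0 < D := hDpos y
  have hDle : D ≤ (dd : ℝ) * π ^ 2 + M := by
    rw [hDdef]
    unfold B4Strip.DeltaXir
    have h1 : ∑ μ, B4Strip.Sxir N (y μ) ≤ ∑ _μ : Fin dd, π ^ 2 := Finset.sum_le_sum fun μ _ =>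
      (B4Strip.Sxir_le N (y μ)).trans (by rw [← sq_abs]; exact pow_le_pow_left₀ (abs_nonneg _) (hy μ) 2)
    rw [Finset.sum_const, Finset.card_univ, Fintype.card_fin, nsmul_eq_mul] at h1
    linarith
  have e : D⁻¹ - (D + t)⁻¹ = t / (D * (D + t)) := by
    field_simp
    ring
  rw [e, mul_div_assoc]
  refine mul_le_mul (B4Strip.Ur_zero_ge N hN y hy) ?_ (by positivity) (B4Strip.Ur_nonneg N _ y)
  exact div_le_div_of_nonneg_left ht (by positivity) (mul_le_mul hDle (by linarith) (by positivity) (by positivity))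

/-- **A UNIFORM MASS GAP FOR KING'S SYMBOL**: `Δ^{(k)}_{M+t}(p′) − Δ^{(k)}_M(p′) ≥ (a⁻¹+M⁻¹)⁻¹(a⁻¹+(M+t)⁻¹)⁻¹·(4∕π²)^d t∕((dπ²+M)(dπ²+M+t))` on the
Brillouin zone (`a, M > 0`, `t > 0`, `N ≥ 1`) — `S₁⁻¹ − S₂⁻¹ = (S₂ − S₁)S₁⁻¹S₂⁻¹` with the tree's `DeltaEff_ge_mass`. [cite: King1986, (4.5) p.670] -/
theorem DeltaEff_mass_gap {a : ℝ} (ha : 0 < a) {N : ℕ} (hN : 1 ≤ N) {M : ℝ} (hM : 0 < M) {t : ℝ} (ht : 0 < t) {y : Fin dd → ℝ}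
    (hy : ∀ μ, |y μ| ≤ π) :
    (4 / π ^ 2) ^ dd * t / (((dd : ℝ) * π ^ 2 + M) * ((dd : ℝ) * π ^ 2 + (M + t)))
        * ((a⁻¹ + (M + t)⁻¹)⁻¹ * (a⁻¹ + M⁻¹)⁻¹)
      ≤ DeltaEff a N (M + t) y - DeltaEff a N M y := by
  have hgap := composedInvResc_mass_gap a⁻¹ hN hM ht.le hy
  have hf₁ := DeltaEff_ge_mass ha hN (by linarith : 0 < M + t) hy
  have hf₂ := DeltaEff_ge_mass ha hN hM hy
  have hS₁pos : 0 < composedInvResc a⁻¹ N (M + t) y :=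
    lt_of_lt_of_le (by positivity) (composedInvResc_ge_zone a⁻¹ hN (by linarith : 0 < M + t) hy)
  have hS₂pos : 0 < composedInvResc a⁻¹ N M y := lt_of_lt_of_le (by positivity) (composedInvResc_ge_zone a⁻¹ hN hM hy)
  unfold DeltaEff at hf₁ hf₂ ⊢
  set S₁ : ℝ := composedInvResc a⁻¹ N (M + t) y with hS₁
  set S₂ : ℝ := composedInvResc a⁻¹ N M y with hS₂
  have e : S₁⁻¹ - S₂⁻¹ = (S₂ - S₁) * (S₁⁻¹ * S₂⁻¹) := by
    field_simp
  rw [e]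
  exact mul_le_mul hgap (mul_le_mul hf₁ hf₂ (by positivity) (inv_nonneg.mpr hS₁pos.le)) (by positivity)
    (le_trans (by positivity) hgap)

end Symbol

/-! ## §2 The mass gap of the effective Laplacian's form and diagonal -/

section Form

variable (N : ℕ) [NeZero N] (U : Fin (d + 1) → ℕ) [∀ μ, NeZero (U μ)]

/-- **`⟨φ, (Δ^{(k)}_{m²+t} − Δ^{(k)}_{m²})φ⟩ ≥ G‖φ‖²`** on EVERY unit torus, uniformly in `N ≥ 1` ((4.35) `effLaplacian_form_DeltaEff` at the two
masses + Plancherel). [cite: King1986, (4.5) p.670, (4.35) p.674] -/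
theorem effLaplacian_mass_gap_form (hN1 : 1 ≤ N) {a m2 : ℝ} (ha : 0 < a) (hm : 0 < m2) {t : ℝ} (ht : 0 < t) (φ : Tor U → ℝ) :
    (4 / π ^ 2) ^ (d + 1) * t / ((((d + 1 : ℕ) : ℝ) * π ^ 2 + m2) * (((d + 1 : ℕ) : ℝ) * π ^ 2 + (m2 + t)))
        * ((a⁻¹ + (m2 + t)⁻¹)⁻¹ * (a⁻¹ + m2⁻¹)⁻¹) * (φ ⬝ᵥ φ)
      ≤ φ ⬝ᵥ (effLaplacian N U a ((N : ℝ) ^ 2) (m2 + t) *ᵥ φ) - φ ⬝ᵥ (effLaplacian N U a ((N : ℝ) ^ 2) m2 *ᵥ φ) := by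
  set G : ℝ := (4 / π ^ 2) ^ (d + 1) * t / ((((d + 1 : ℕ) : ℝ) * π ^ 2 + m2) * (((d + 1 : ℕ) : ℝ) * π ^ 2 + (m2 + t)))
    * ((a⁻¹ + (m2 + t)⁻¹)⁻¹ * (a⁻¹ + m2⁻¹)⁻¹) with hGdef
  have hcard : (0 : ℝ) < Fintype.card (Tor U) := by exact_mod_cast Fintype.card_pos
  have hform₁ := effLaplacian_form_DeltaEff N U hN1 ha (by linarith : 0 < m2 + t) φ
  have hform₂ := effLaplacian_form_DeltaEff N U hN1 ha hm φ
  have hpar := parseval_dot U φ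
  have hsum : G * ∑ q : Tor U, ‖ft U φ q‖ ^ 2
      ≤ ∑ q : Tor U, (DeltaEff a N (m2 + t) (sOf U q) - DeltaEff a N m2 (sOf U q)) * ‖ft U φ q‖ ^ 2 := by
    rw [Finset.mul_sum]
    exact Finset.sum_le_sum fun q _ => mul_le_mul_of_nonneg_right (DeltaEff_mass_gap ha hN1 hm ht (abs_sOf_le U q)) (sq_nonneg _)
  have hsplit : ∑ q : Tor U, (DeltaEff a N (m2 + t) (sOf U q) - DeltaEff a N m2 (sOf U q)) * ‖ft U φ q‖ ^ 2
      = (Fintype.card (Tor U) : ℝ) * (φ ⬝ᵥ (effLaplacian N U a ((N : ℝ) ^ 2) (m2 + t) *ᵥ φ))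
        - (Fintype.card (Tor U) : ℝ) * (φ ⬝ᵥ (effLaplacian N U a ((N : ℝ) ^ 2) m2 *ᵥ φ)) := by
    rw [hform₁, hform₂, ← Finset.sum_sub_distrib]
    exact Finset.sum_congr rfl fun q _ => by ring
  rw [hsplit, ← hpar] at hsum
  have h2 : (Fintype.card (Tor U) : ℝ) * (G * (φ ⬝ᵥ φ))
      ≤ (Fintype.card (Tor U) : ℝ) * (φ ⬝ᵥ (effLaplacian N U a ((N : ℝ) ^ 2) (m2 + t) *ᵥ φ)
          - φ ⬝ᵥ (effLaplacian N U a ((N : ℝ) ^ 2) m2 *ᵥ φ)) := by linarith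
  exact le_of_mul_le_mul_left h2 hcard

/-- **`Δ^{(k)}_{m²+t}(b,b) − Δ^{(k)}_{m²}(b,b) ≥ G > 0`** at every unit site, uniformly in `N ≥ 1` and the torus. [cite: King1986, (4.5) p.670, (4.35) p.674] -/
theorem effLaplacian_mass_gap_diag (hN1 : 1 ≤ N) {a m2 : ℝ} (ha : 0 < a) (hm : 0 < m2) {t : ℝ} (ht : 0 < t) (b : Tor U) :
    (4 / π ^ 2) ^ (d + 1) * t / ((((d + 1 : ℕ) : ℝ) * π ^ 2 + m2) * (((d + 1 : ℕ) : ℝ) * π ^ 2 + (m2 + t)))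
        * ((a⁻¹ + (m2 + t)⁻¹)⁻¹ * (a⁻¹ + m2⁻¹)⁻¹)
      ≤ effLaplacian N U a ((N : ℝ) ^ 2) (m2 + t) b b - effLaplacian N U a ((N : ℝ) ^ 2) m2 b b := by
  have h := effLaplacian_mass_gap_form N U hN1 ha hm ht (Pi.single b 1)
  simp only [Matrix.mulVec_single_one, single_dotProduct, one_mul, Matrix.col_apply, Pi.single_eq_same, mul_one] at h
  exact h

end Form

/-! ## §3 A constant potential is a mass shift -/

section Const

variable {N : ℕ} [NeZero N] {U : Fin (d + 1) → ℕ} [∀ μ, NeZero (U μ)]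

omit [NeZero N] [∀ μ, NeZero (U μ)] in
/-- `c(−Δ) + (m² + t) = (c(−Δ) + m²) + t·1` for King's fine-lattice operator. [folklore] -/
theorem lapF_add_mass (c m2 t : ℝ) :
    lapF (fine N U) c (m2 + t) = lapF (fine N U) c m2 + Matrix.diagonal (fun _ => t) := by
  ext z z'
  rw [Matrix.add_apply, Matrix.diagonal_apply]
  simp only [lapF]
  by_cases h : z = z'
  · subst h
    simp only [if_true]
    ring
  · rw [if_neg (Ne.symm h), if_neg h]
    ring

/-- **A CONSTANT POTENTIAL IS A MASS SHIFT**: `A₀(m²) + diag(t·1) = A₀(m² + t)`. [cite: King1986, (4.1)–(4.5) p.670 (the operator `A₀`)] -/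
theorem fineOpPot_const (a c m2 t : ℝ) : fineOpPot N U a c m2 (fun _ => t) = fineOp N U a c (m2 + t) := by
  rw [fineOpPot, fineOp, fineOp, lapF_add_mass]
  abel

/-- **THE DRESSED MINIMISER AT A CONSTANT POTENTIAL IS THE UNDRESSED ONE AT THE SHIFTED MASS**: `ℋ_{k, t·1} = ℋ_k|_{m² ↦ m²+t}`.
[cite: King1986, (2.13)–(2.15) p.653] -/
theorem kingHPot_const (L : ℕ) (a m2 : ℝ) (k : ℕ) (t : ℝ) (b : Tor U) (x : Tor (fine N U)) :
    kingHPot L N U a m2 k (fun _ => t) b x = kingH L N U a (m2 + t) k b x := by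
  rw [kingHPot, fineOpPot_const]
  exact (minimiser_single_apply b x).symm

/-- The points over `x` lie in the finer block fibre of `B(x)`. [cite: King1986, p.664 («x′ ∈ B^n(x)»)] -/
theorem blockOf_overOff (L : ℕ) [NeZero L] (k : ℕ) (x : Tor (fine (L ^ k) U)) (i : Fin (d + 1) → Fin L) :
    blockOf (L ^ 1 * L ^ k) U (overOff L U k x i) = blockOf (L ^ k) U x := by
  rw [← blockOf_underPtN L k 1 U (overOff L U k x i), underPtN_overOff]

end Const

/-! ## §4 The lower bound for the size-regular, incoherent tower -/

section Lower

variable (L : ℕ) [NeZero L]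

/-- **THE ONE-STEP SUP ENTRY OF THE SIZE-REGULAR INCOHERENT TOWER IS BOUNDED BELOW** (odd `L ≥ 3`, `a, m² > 0`, `c > 0`): there are `g > 0`,
`C ≥ 0` such that for every volume exponent `e`, every `k ≥ 1` and every unit site `b`,
`sup_{B(x′) = b} |ℋ_{k+1}^{m²}(x′,b) − ℋ_k^{m²+c}(x,b)| ≥ g − C(L^{−1∕2})^k` (`x` under `x′`): every `x ∈ B(b)` is under some `x′` of the block, so
the sup dominates the block mean of `ℋ_k^{m²}(·,b) − ℋ_k^{m²+c}(·,b)` (`= a_k⁻¹(Δ_{m²+c} − Δ_{m²})(b,b) ≥ G_min∕a`, part 20's `blockMean_kingH_eq`)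
minus the undressed step (part 8b `kingH_step_kingU`). [cite: King1986, (2.13)–(2.15) p.653, (4.5) p.670, Prop. 3.8 (3.71) p.664 (A = 0 model)] -/
theorem siteSup_sizeOnly_ge (hLodd : Odd L) (hL : 2 ≤ L) {a m2 : ℝ} (ha : 0 < a) (hm : 0 < m2) {c : ℝ} (hc : 0 < c) :
    ∃ g C : ℝ, 0 < g ∧ 0 ≤ C ∧ ∀ (e k : ℕ), 1 ≤ k → ∀ b : Tor (kingU d L e),
      g - C * ((L : ℝ) ^ (-(1 / 2 : ℝ))) ^ k ≤
        (kingBlockFibre (L ^ 1 * L ^ k) (kingU d L e) b).sup' (kingBlockFibre_nonempty _ _ b) (fun x' =>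
          |kingH L (L ^ 1 * L ^ k) (kingU d L e) a m2 (k + 1) b x'
            - kingH L (L ^ k) (kingU d L e) a (m2 + c) k b (underPtN L k 1 (kingU d L e) x')|) := by
  have hL1 : 1 < L := by omega
  have hLr : (1 : ℝ) < L := by exact_mod_cast hL1
  obtain ⟨δS, CS, hδS, hCS, HS⟩ := kingH_step_kingU (d := d) L hLodd hL ha hm
  have hamin : 0 < aminL a L := aminL_pos ha hL
  -- the mass gap at the smallest coefficient `a_min`, and the resulting `g`
  set Gm : ℝ := (4 / π ^ 2) ^ (d + 1) * c / ((((d + 1 : ℕ) : ℝ) * π ^ 2 + m2) * (((d + 1 : ℕ) : ℝ) * π ^ 2 + (m2 + c)))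
    * (((aminL a L)⁻¹ + (m2 + c)⁻¹)⁻¹ * ((aminL a L)⁻¹ + m2⁻¹)⁻¹) with hGmdef
  have hGm : 0 < Gm := by positivity
  refine ⟨Gm / a, CS, by positivity, hCS.le, fun e k hk b => ?_⟩
  set r : ℝ := (L : ℝ) ^ (-(1 / 2 : ℝ)) with hrdef
  have hr0 : 0 ≤ r := Real.rpow_nonneg (Nat.cast_nonneg _) _
  have hak : 0 < aK a L k := aK_pos ha hLr hk
  have hamk : aminL a L ≤ aK a L k := (aminL_le_aK ha hL hk).1
  have haka : aK a L k ≤ a := (aminL_le_aK ha hL hk).2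
  have hN1 : 1 ≤ L ^ k := Nat.one_le_pow _ _ (by omega)
  have hD : (0 : ℝ) < ((L ^ k : ℕ) : ℝ) ^ (d + 1) := pow_pos (Nat.cast_pos.mpr (by omega)) _
  set S : ℝ := (kingBlockFibre (L ^ 1 * L ^ k) (kingU d L e) b).sup' (kingBlockFibre_nonempty _ _ b) (fun x' =>
    |kingH L (L ^ 1 * L ^ k) (kingU d L e) a m2 (k + 1) b x'
      - kingH L (L ^ k) (kingU d L e) a (m2 + c) k b (underPtN L k 1 (kingU d L e) x')|) with hSdef
  -- the block-mean function: the difference of the minimisers at the two masses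
  set G : Tor (fine (L ^ k) (kingU d L e)) → ℝ := fun x =>
    kingH L (L ^ k) (kingU d L e) a m2 k b x - kingH L (L ^ k) (kingU d L e) a (m2 + c) k b x with hGdef
  -- §a each coarse point of the block is dominated by the sup plus the undressed step
  have hpt : ∀ j : Fin (d + 1) → Fin (L ^ k), G (site (L ^ k) (kingU d L e) b j) ≤ S + CS * r ^ k := by
    intro j
    set x : Tor (fine (L ^ k) (kingU d L e)) := site (L ^ k) (kingU d L e) b j with hxdef
    set x' : Tor (fine (L ^ 1 * L ^ k) (kingU d L e)) := overOff L (kingU d L e) k x 0 with hx'def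
    have hxb : blockOf (L ^ k) (kingU d L e) x = b := blockOf_site (L ^ k) (kingU d L e) b j
    have hx'b : blockOf (L ^ 1 * L ^ k) (kingU d L e) x' = b := by rw [hx'def, blockOf_overOff, hxb]
    have hmem : x' ∈ kingBlockFibre (L ^ 1 * L ^ k) (kingU d L e) b := (mem_kingBlockFibre _ _ b x').2 hx'b
    have hunder : underPtN L k 1 (kingU d L e) x' = x := underPtN_overOff L (kingU d L e) k x 0
    have hsup : |kingH L (L ^ 1 * L ^ k) (kingU d L e) a m2 (k + 1) b x' - kingH L (L ^ k) (kingU d L e) a (m2 + c) k b x| ≤ S := by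
      have h := Finset.le_sup' (fun x' => |kingH L (L ^ 1 * L ^ k) (kingU d L e) a m2 (k + 1) b x'
        - kingH L (L ^ k) (kingU d L e) a (m2 + c) k b (underPtN L k 1 (kingU d L e) x')|) hmem
      rwa [hunder] at h
    have hstep : |kingH L (L ^ 1 * L ^ k) (kingU d L e) a m2 (k + 1) b x' - kingH L (L ^ k) (kingU d L e) a m2 k b x|
        ≤ CS * r ^ k := by
      have h := HS e k hk b x'
      rw [hunder, hx'b, (tdistT_isPseudoDist (kingU d L e)).zero, mul_zero, neg_zero, Real.exp_zero, mul_one] at h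
      exact h
    have htri : |G x| ≤ |kingH L (L ^ 1 * L ^ k) (kingU d L e) a m2 (k + 1) b x' - kingH L (L ^ k) (kingU d L e) a m2 k b x|
        + |kingH L (L ^ 1 * L ^ k) (kingU d L e) a m2 (k + 1) b x' - kingH L (L ^ k) (kingU d L e) a (m2 + c) k b x| := by
      rw [hGdef]
      calc |kingH L (L ^ k) (kingU d L e) a m2 k b x - kingH L (L ^ k) (kingU d L e) a (m2 + c) k b x|
          ≤ |kingH L (L ^ k) (kingU d L e) a m2 k b x - kingH L (L ^ 1 * L ^ k) (kingU d L e) a m2 (k + 1) b x'|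
            + |kingH L (L ^ 1 * L ^ k) (kingU d L e) a m2 (k + 1) b x' - kingH L (L ^ k) (kingU d L e) a (m2 + c) k b x| :=
            abs_sub_le _ _ _
        _ = _ := by rw [abs_sub_comm (kingH L (L ^ k) (kingU d L e) a m2 k b x)]
    linarith [le_abs_self (G x)]
  -- §b average over the block: the block means of part 20 at the two masses
  have hmean : (((L ^ k : ℕ) : ℝ) ^ (d + 1))⁻¹ * ∑ j : Fin (d + 1) → Fin (L ^ k), G (site (L ^ k) (kingU d L e) b j)
      = (aK a L k)⁻¹ * (effLaplacian (L ^ k) (kingU d L e) (aK a L k) (((L ^ k : ℕ) : ℝ) ^ 2) (m2 + c) b b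
          - effLaplacian (L ^ k) (kingU d L e) (aK a L k) (((L ^ k : ℕ) : ℝ) ^ 2) m2 b b) := by
    have h1 := blockMean_kingH_eq (L ^ k) (kingU d L e) L a m2 hak.ne' b
    have h2 := blockMean_kingH_eq (L ^ k) (kingU d L e) L a (m2 + c) hak.ne' b
    simp only [hGdef, Finset.sum_sub_distrib, mul_sub, h1, h2]
    ring
  have hgap := effLaplacian_mass_gap_diag (L ^ k) (kingU d L e) hN1 hak hm hc b
  -- the gap at `a_k` dominates the gap at `a_min`
  have hmono : Gm ≤ (4 / π ^ 2) ^ (d + 1) * c / ((((d + 1 : ℕ) : ℝ) * π ^ 2 + m2) * (((d + 1 : ℕ) : ℝ) * π ^ 2 + (m2 + c)))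
      * (((aK a L k)⁻¹ + (m2 + c)⁻¹)⁻¹ * ((aK a L k)⁻¹ + m2⁻¹)⁻¹) := by
    have hi : (aK a L k)⁻¹ ≤ (aminL a L)⁻¹ := inv_anti₀ hamin hamk
    refine mul_le_mul_of_nonneg_left (mul_le_mul (inv_anti₀ (by positivity) (by linarith))
      (inv_anti₀ (by positivity) (by linarith)) (by positivity) (by positivity)) (by positivity)
  have hsumle : ∑ j : Fin (d + 1) → Fin (L ^ k), G (site (L ^ k) (kingU d L e) b j)
      ≤ ((L ^ k : ℕ) : ℝ) ^ (d + 1) * (S + CS * r ^ k) := by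
    have h := Finset.sum_le_sum fun (j : Fin (d + 1) → Fin (L ^ k)) (_ : j ∈ Finset.univ) => hpt j
    rwa [Finset.sum_const, Finset.card_univ, nsmul_eq_mul, card_offsets (L ^ k)] at h
  have havg : (((L ^ k : ℕ) : ℝ) ^ (d + 1))⁻¹ * ∑ j : Fin (d + 1) → Fin (L ^ k), G (site (L ^ k) (kingU d L e) b j)
      ≤ S + CS * r ^ k := by
    rw [inv_mul_le_iff₀ hD]
    exact hsumle
  rw [hmean] at havg
  -- `G_min∕a ≤ a_k⁻¹·(gap) ≤ S + C_S r^k`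
  have h3 : Gm / a ≤ (aK a L k)⁻¹ * (effLaplacian (L ^ k) (kingU d L e) (aK a L k) (((L ^ k : ℕ) : ℝ) ^ 2) (m2 + c) b b
      - effLaplacian (L ^ k) (kingU d L e) (aK a L k) (((L ^ k : ℕ) : ℝ) ^ 2) m2 b b) := by
    rw [div_eq_inv_mul]
    exact mul_le_mul (inv_anti₀ hak haka) (hmono.trans hgap) hGm.le (inv_nonneg.mpr hak.le)
  show Gm / a - CS * r ^ k ≤ S
  linarith

/-- **THE DRESSED SITE ENTRY OF THE WITNESS TOWER IS BOUNDED BELOW ON THE PART-8c FAMILY**: with `g, C` of `siteSup_sizeOnly_ge` (for the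
size `c > 0`), for every coherence rate `s`, every index `i` and every unit site `b`, the tower `v_N = c·[N = L^{i.k}]` has
`(kingHSiteV L a m² s i).ker v b b ≥ g − C(L^{−1∕2})^{i.k}`. [cite: King1986, (2.13)–(2.15) p.653, (4.5) p.670 (A = 0 model)] -/
theorem kingHSiteV_sizeOnly_ge (hLodd : Odd L) (hL : 2 ≤ L) {a m2 : ℝ} (ha : 0 < a) (hm : 0 < m2) {c : ℝ} (hc : 0 < c) :
    ∃ g C : ℝ, 0 < g ∧ 0 ≤ C ∧ ∀ (s : ℝ) (i : KingPotIdx d) (b : Tor (kingU d L i.e)),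
      g - C * ((L : ℝ) ^ (-(1 / 2 : ℝ))) ^ i.k
        ≤ (kingHSiteV L a m2 s i).ker (fun N _ => if N = L ^ i.k then c else 0) b b := by
  obtain ⟨g, C, hg, hC, H⟩ := siteSup_sizeOnly_ge (d := d) L hLodd hL ha hm hc
  refine ⟨g, C, hg, hC, fun s i b => ?_⟩
  have hne : ¬ (L ^ 1 * L ^ i.k = L ^ i.k) := by
    have h1 : L ^ i.k < L ^ 1 * L ^ i.k := by
      rw [← pow_add]
      exact Nat.pow_lt_pow_right (by omega) (by omega)
    omega
  have h := H i.e i.k i.one_le_k b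
  show _ ≤ (kingBlockFibre (L ^ 1 * L ^ i.k) (kingU d L i.e) b).sup' (kingBlockFibre_nonempty _ _ b) (fun x' =>
    |kingHPot L (L ^ 1 * L ^ i.k) (kingU d L i.e) a m2 (i.k + 1) (fun _ => if L ^ 1 * L ^ i.k = L ^ i.k then c else 0) b x'
      - kingHPot L (L ^ i.k) (kingU d L i.e) a m2 i.k (fun _ => if L ^ i.k = L ^ i.k then c else 0) b
          (underPtN L i.k 1 (kingU d L i.e) x')|)
  simp only [if_neg hne, if_true, kingHPot_const, add_zero]
  exact h

end Lower

/-! ## §5 `NE2PlusSite` fails for the dressed minimiser on the size-only sort -/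

section NotSite

variable (L : ℕ) [NeZero L]

/-- **`NE2PlusSite` FAILS FOR THE DRESSED MINIMISER'S SUP ENTRY ON THE SIZE-ONLY SORT** (odd `L ≥ 3`, `a, m² > 0`; EVERY `c₃₅ > 0`, `s`, `d′`,
`p`): `¬ NE2PlusSite d′ p c₃₅ (kingInstanceV L s) (kingHSiteV L a m² s)`.  Given constants `(M₅, δ, a₀, C, γ)`, take the index
`(e, k, n, Msz) = (0, k, 1, max M₅ 1)`, `α₀ = a₀∕Msz`, and the (3.35)-regular tower `v_N = c₃₅α₀·[N = L^k]`: `EtaRateIneqSite` at `(b,b)` would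
give `ker v b b ≤ C(L^{−γ})^k`, against §4's `ker v b b ≥ g − C_S(L^{−1∕2})^k` — false for `k` large.  CONTRAST: on the size-and-coherence sort the
same kernel satisfies `NE2PlusSite` (part 15 `ne2PlusSite_kingHSC`).  HONEST SCOPE: module docstring.
[cite: Balaban1985BackgroundPropagators, (3.35)–(3.36) p.396 + (3.133) p.422 + Thm 3.14 pp.426–427 (quantifier template); King1986, (2.13)–(2.15) p.653, (4.5) p.670, Prop. 3.8 (3.71) p.664 (A = 0 model)] -/
theorem not_ne2PlusSite_kingHV (hLodd : Odd L) (hL : 2 ≤ L) {a m2 : ℝ} (ha : 0 < a) (hm : 0 < m2) {c35 : ℝ} (hc : 0 < c35)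
    (s : ℝ) (d' : ℕ) (p : ℝ) : ¬ NE2PlusSite d' p c35 (kingInstanceV (d := d) L s) (kingHSiteV L a m2 s) := by
  rintro ⟨M₅, δ, a₀, C, γ, hM, hδ, ha₀, hC, hγ, H⟩
  have hL1 : 1 < L := by omega
  have hLr : (1 : ℝ) < L := by exact_mod_cast hL1
  -- the size letter and the window
  set Msz : ℝ := max M₅ 1 with hMszdef
  have hMsz1 : 1 ≤ Msz := le_max_right _ _
  have hMszpos : 0 < Msz := by positivity
  set α₀ : ℝ := a₀ / Msz with hα₀def
  have hα₀ : 0 < α₀ := by positivity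
  have hMa : Msz * α₀ ≤ a₀ := by
    rw [hα₀def, mul_div_cancel₀ a₀ hMszpos.ne']
  have hcα : 0 < c35 * α₀ := by positivity
  obtain ⟨g, CS, hg, hCS, Hlow⟩ := kingHSiteV_sizeOnly_ge (d := d) L hLodd hL ha hm hcα
  -- the two rates and a level beating both
  set r : ℝ := (L : ℝ) ^ (-(1 / 2 : ℝ)) with hrdef
  set θ : ℝ := (L : ℝ) ^ (-γ) with hθdef
  have hr0 : 0 ≤ r := Real.rpow_nonneg (Nat.cast_nonneg _) _
  have hθ0 : 0 ≤ θ := Real.rpow_nonneg (Nat.cast_nonneg _) _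
  have hr1 : r < 1 := Real.rpow_lt_one_of_one_lt_of_neg hLr (by norm_num)
  have hθ1 : θ < 1 := Real.rpow_lt_one_of_one_lt_of_neg hLr (by linarith)
  obtain ⟨n₁, hn₁⟩ := exists_pow_lt_of_lt_one (show 0 < g / 4 / (CS + 1) by positivity) hr1
  obtain ⟨n₂, hn₂⟩ := exists_pow_lt_of_lt_one (show 0 < g / 4 / C by positivity) hθ1
  set k : ℕ := n₁ + n₂ + 1 with hkdef
  have hk1 : 1 ≤ k := by omega
  have hrk : r ^ k ≤ r ^ n₁ := pow_le_pow_of_le_one hr0 hr1.le (by omega)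
  have hθk : θ ^ k ≤ θ ^ n₂ := pow_le_pow_of_le_one hθ0 hθ1.le (by omega)
  have hsmall₁ : CS * r ^ k ≤ g / 4 := by
    have h1 : CS * r ^ k ≤ (CS + 1) * r ^ n₁ := mul_le_mul (by linarith) hrk (pow_nonneg hr0 _) (by linarith)
    have h2 : (CS + 1) * r ^ n₁ ≤ (CS + 1) * (g / 4 / (CS + 1)) := mul_le_mul_of_nonneg_left hn₁.le (by linarith)
    have h3 : (CS + 1) * (g / 4 / (CS + 1)) = g / 4 := by field_simp
    linarith
  have hsmall₂ : C * θ ^ k ≤ g / 4 := by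
    have h3 : C * (g / 4 / C) = g / 4 := by field_simp
    linarith [mul_le_mul_of_nonneg_left (hθk.trans hn₂.le) hC.le]
  -- the index, the site, and the (3.35)-regular incoherent tower
  set i : KingPotIdx d := ⟨0, k, hk1, 1, le_rfl, Msz, hMsz1⟩ with hidef
  set b : Tor (kingU d L 0) := fun _ => 0 with hbdef
  have h335 : (kingInstanceV (d := d) L s i).Bf.Reg335 c35 α₀ (fun N _ => if N = L ^ k then c35 * α₀ else 0) := by
    intro N x
    show |(if N = L ^ k then c35 * α₀ else (0 : ℝ))| ≤ c35 * α₀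
    by_cases h : N = L ^ k
    · rw [if_pos h, abs_of_pos hcα]
    · rw [if_neg h, abs_zero]; exact hcα.le
  have hineq := H i (le_max_left M₅ 1) α₀ hα₀ hMa _ h335 b b
  simp only [kingInstanceV_len, kingInstanceV_rateFactor_rpow L hL, max_self, Real.one_rpow, mul_one] at hineq
  have hexp : Real.exp (-(δ * (kingInstanceV (d := d) L s i).gc.dist b b)) ≤ 1 := by
    rw [Real.exp_le_one_iff]
    have h0 : 0 ≤ (kingInstanceV (d := d) L s i).gc.dist b b := (tdistT_isPseudoDist (kingU d L 0)).nonneg b b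
    nlinarith
  have hup : (kingHSiteV L a m2 s i).ker (fun N _ => if N = L ^ k then c35 * α₀ else 0) b b ≤ C * θ ^ k := by
    refine (le_abs_self _).trans (hineq.trans ?_)
    have : C * Real.exp (-(δ * (kingInstanceV (d := d) L s i).gc.dist b b)) ≤ C := mul_le_of_le_one_right hC.le hexp
    exact mul_le_mul_of_nonneg_right this (pow_nonneg hθ0 _)
  have hlow := Hlow s i b
  rw [show i.k = k from rfl] at hlow
  linarith

end NotSite

end Summit.QuantumFields.YangMills.BalabanUVNodes.N15.KingModel

end
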